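import Summits.Schanuel.Schanuel.Theses.MisiurewiczField
import Literature.NumberTheory.Transcendental.KirbyWeakSchanuelAx
import Literature.NumberTheory.Transcendental.EclClosureOperatorProofs
import Literature.NumberTheory.Transcendental.SchanuelEclEmptyProofs

/-!
# Birth skeleton — crux `MisiurewiczField.OffMisiurewiczSector`
# (stmt-Schanuel-12576, route-Schanuel-MisiurewiczField, rank 6; BC3 registrar, 2026-08-17)

THE CRUX (verbatim, `offMisiurewiczSector_iff` below is `Iff.rfl`). Let
`M = {a_{j+1}(l) : l Misiurewicz (post-singularly finite), j ∈ ℕ}` be the Misiurewicz orbit set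
(`misSet`) and `K₀ = ℚ(M)` the Misiurewicz field. For `x : Fin n → ℂ` that is `ℚ`-linearly
independent MODULO `span_ℚ M`: `n ≤ trdeg_{K₀} K₀(x, eˣ)` — Schanuel relative to `K₀`.

THE LINE ("core localisation + finitely generated bases"; the decomposition the crux docstring
itself names: "by Kirby's PROVED relative theorem its content is carried by core tuples modulo the
Misiurewicz span", and the why-it-might-fail objection "no transcendence method works relative to
the infinitely generated base ℚ(M)"). Write `C := ecl M` (Kirby's exponential-algebraic closure of
`M` in `ℂ_exp`; countable, an exp-closed relatively algebraically closed subfield containing `K₀`,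
`ecl`-closed by `Kirby2010_ecl_idem_holds`).

* `stub_coreReduction` (PROVABLE NOW, M/L; Kirby 2010 Thm 1.2 at `C = ecl M` =
  `Kirby2010_weakSchanuel_complex_holds` + the `GL_n(ℤ)` bookkeeping of
  `schanuelConjecture_iff_ecl_empty_of_kirby` redone over the base `K₀` instead of `ℚ`): every
  tuple `x` independent modulo `span M` splits, after an integral change of basis, into a CORE part
  `y : Fin k → span_ℚ C` (still independent modulo `span M`) and a part `u : Fin (n-k)` independent
  modulo `span C`; `K₀(y, e^y) ⊆ ℚ(C)`, so the tower law and base change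
  (`add_le_trdeg_adjoin_union`, `trdeg_adjoin_le_of_le`) plus Kirby's theorem on `u` give
  `trdeg_{K₀} K₀(x, eˣ) ≥ trdeg_{K₀} K₀(y, e^y) + (n - k)`.
* `stub_directedUnion` (PROVABLE NOW, M; pure field theory): an algebraic dependence over
  `K₀ = ℚ(M)` among the `2k` generators `y, e^y` involves finitely many elements of `M`, so
  `(∀ finite S ⊆ M, k ≤ trdeg_{ℚ(S)} ℚ(S)(y, e^y)) → k ≤ trdeg_{K₀} K₀(y, e^y)`.
* `stub_coreFiniteBase` (OPEN — the HARDEST stub; all the Schanuel-hard content, now over a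
  FINITELY GENERATED base and for CORE tuples only): for every finite `S ⊆ M` and every core tuple
  `y ⊆ span_ℚ (ecl M)` independent modulo `span M`, `k ≤ trdeg_{ℚ(S)} ℚ(S)(y, e^y)`.
  (Schanuel ⇒ it: orbit-close `S` to `S'`, take a `ℚ`-basis `b ⊆ S'` of `span S'`; `e^{b} ⊆ ℚ(S')
  = ℚ(b)` because `e^{a_j} = a_{j+1}/a_1`; Schanuel at `(b, y)` and `trdeg ℚ(S') ≤ |b|`. The crux ⇒
  it by base change `ℚ(S) ≤ K₀`. So it is no stronger than the crux.)

`offMisiurewiczSector_of_parts : stub₁-sig → stub₂-sig → stub₃-sig → (crux, §0 normal form)` is the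
sorry-free glue (axioms certified by `#guard_msgs` below) and
`OffMisiurewiczSector_of : OffMisiurewiczSector` composes the three stubs BY NAME into the crux
(kernel-checked; `sorry` only inside the three `stub_*`): from `stub_coreReduction` get `(k, y)`;
`stub_coreFiniteBase` at every finite `S` feeds `stub_directedUnion`, giving
`k ≤ trdeg_{K₀} K₀(y, e^y)`; then `n = k + (n - k) ≤ trdeg_{K₀} K₀(y, e^y) + (n - k) ≤ trdeg_{K₀} K₀(x, eˣ)`.

## Disproof used
No `Cruxes/OffMisiurewiczSector/Disproof.lean` exists (crux dir empty at registration,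
`ledger crux ls stmt-Schanuel-12576`, 2026-08-17); no landed `Theorems/OffMisiurewiczSector/Negative/*`.
Refuter evidence `Evidence12576.lean` (2026-08-15): the bare conclusion is false at `x = (0)` and the
mutation "mod span M → ℚ-independent" is false at `x = (2πi)` — every stub keeps the hypothesis
"independent modulo `span M`" (stubs 1, 3) or carries no independence claim (stub 2).
`ledger negatives --problem Schanuel`: the PolarPhantoms refutations — unrelated to relative
transcendence degrees.
-/

set_option linter.dupNamespace false
set_option linter.unusedVariables false

noncomputable section

namespace Summit.Schanuel.Schanuel.Cruxes.OffMisiurewiczSector.Birth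

open Summit.Schanuel.Schanuel.Theses.MisiurewiczField (OffMisiurewiczSector)
open Literature.NumberTheory.Transcendental (ecl)
open Literature.Dynamics.ExponentialFamily (IsPostsingularlyFinite postsingularOrbit)

/-! ## §0 Vocabulary of the crux (verbatim sub-expressions of `OffMisiurewiczSector`) -/

/-- The Misiurewicz orbit set `M = {a_{j+1}(l) : l post-singularly finite, j ∈ ℕ}` — verbatim the
set written (three times) in the crux. -/
def misSet : Set ℂ :=
  {w : ℂ | ∃ l : ℂ, IsPostsingularlyFinite l ∧ ∃ j : ℕ, w = postsingularOrbit l (j + 1)}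

/-- `trdeg_{ℚ(B)} ℚ(B)(x, eˣ)`: the transcendence degree, over the base `ℚ(B)`, of the field
generated over `ℚ(B)` by the tuple `x` and its exponentials — verbatim the shape of the crux's
conclusion (there `B = M`). -/
def tdOver (B : Set ℂ) {n : ℕ} (x : Fin n → ℂ) : Cardinal :=
  Algebra.trdeg ↥(IntermediateField.adjoin ℚ B)
    ↥(IntermediateField.adjoin ↥(IntermediateField.adjoin ℚ B)
      (Set.range x ∪ Set.range (Complex.exp ∘ x)))

/-- The crux in §0 vocabulary — definitional (`Iff.rfl`). -/
theorem offMisiurewiczSector_iff :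
    OffMisiurewiczSector ↔
      ∀ (n : ℕ) (x : Fin n → ℂ), LinearIndependent ℚ ((Submodule.span ℚ misSet).mkQ ∘ x) →
        (n : Cardinal) ≤ tdOver misSet x :=
  Iff.rfl

/-! ## §1 The three registered stubs -/

/-- **stub_coreFiniteBase** (OPEN — the hardest stub). Schanuel relative to every FINITELY
GENERATED Misiurewicz base `ℚ(S)`, `S ⊆ M` finite, for CORE tuples: if `y : Fin k → ℂ` has all
entries in `span_ℚ (ecl M)` and is `ℚ`-independent modulo `span_ℚ M`, then
`k ≤ trdeg_{ℚ(S)} ℚ(S)(y, e^y)`. Implied by the crux (base change `ℚ(S) ≤ ℚ(M)`) and by Schanuel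
(orbit-close `S`, basis `b ⊆ S'`, `e^b ⊆ ℚ(S') = ℚ(b)`); size: open problem. -/
theorem stub_coreFiniteBase :
    ∀ (S : Set ℂ), S.Finite → S ⊆ misSet →
      ∀ (k : ℕ) (y : Fin k → ℂ), (∀ i, y i ∈ Submodule.span ℚ (ecl misSet)) →
        LinearIndependent ℚ ((Submodule.span ℚ misSet).mkQ ∘ y) →
          (k : Cardinal) ≤ tdOver S y := by
  sorry

/-- **stub_directedUnion** (provable now, M; pure field theory). `K₀ = ℚ(M)` is the directed
union of the `ℚ(S)`, `S ⊆ M` finite, and an algebraic dependence over `K₀` among the finitely many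
generators `y, e^y` is defined over some `ℚ(S)`: lower bounds for `trdeg_{ℚ(S)} ℚ(S)(y, e^y)` that
hold for EVERY finite `S ⊆ M` pass to `trdeg_{K₀} K₀(y, e^y)`. -/
theorem stub_directedUnion :
    ∀ (k : ℕ) (y : Fin k → ℂ),
      (∀ (S : Set ℂ), S.Finite → S ⊆ misSet → (k : Cardinal) ≤ tdOver S y) →
        (k : Cardinal) ≤ tdOver misSet y := by
  sorry

/-- **stub_coreReduction** (provable now, M/L; Kirby 2010 Thm 1.2 at `C = ecl M`, in the tree as
`Kirby2010_weakSchanuel_complex_holds` with `Kirby2010_ecl_idem_holds`, plus the `GL_n(ℤ)`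
bookkeeping of `schanuelConjecture_iff_ecl_empty_of_kirby` over the base `K₀`). Every tuple `x`
that is `ℚ`-independent modulo `span M` has a CORE SHADOW `y : Fin k → span_ℚ (ecl M)`, `k ≤ n`,
still independent modulo `span M`, with
`trdeg_{K₀} K₀(y, e^y) + (n - k) ≤ trdeg_{K₀} K₀(x, eˣ)` (the `n - k` is Kirby's theorem applied to
the complement of the shadow, which is independent modulo `span (ecl M)`). -/
theorem stub_coreReduction :
    ∀ (n : ℕ) (x : Fin n → ℂ), LinearIndependent ℚ ((Submodule.span ℚ misSet).mkQ ∘ x) →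
      ∃ (k : ℕ) (y : Fin k → ℂ), k ≤ n ∧ (∀ i, y i ∈ Submodule.span ℚ (ecl misSet)) ∧
        LinearIndependent ℚ ((Submodule.span ℚ misSet).mkQ ∘ y) ∧
          tdOver misSet y + ((n - k : ℕ) : Cardinal) ≤ tdOver misSet x := by
  sorry

/-! ## §2 The composition (kernel-checked, no `sorry`) -/

/-- **The glue of the line, sorry-free**: the three stub STATEMENTS (verbatim the types of
`stub_coreFiniteBase`, `stub_directedUnion`, `stub_coreReduction`, as hypotheses) imply the crux in
its §0 normal form (`offMisiurewiczSector_iff`). From `stub_coreReduction` get the core shadow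
`(k, y)`; `stub_coreFiniteBase` at every finite `S ⊆ M` feeds `stub_directedUnion`, giving
`k ≤ trdeg_{K₀} K₀(y, e^y)`; then `n = k + (n - k) ≤ trdeg_{K₀} K₀(y, e^y) + (n - k) ≤ trdeg_{K₀} K₀(x, eˣ)`. -/
theorem offMisiurewiczSector_of_parts :
    (∀ (S : Set ℂ), S.Finite → S ⊆ misSet →
      ∀ (k : ℕ) (y : Fin k → ℂ), (∀ i, y i ∈ Submodule.span ℚ (ecl misSet)) →
        LinearIndependent ℚ ((Submodule.span ℚ misSet).mkQ ∘ y) →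
          (k : Cardinal) ≤ tdOver S y) →
    (∀ (k : ℕ) (y : Fin k → ℂ),
      (∀ (S : Set ℂ), S.Finite → S ⊆ misSet → (k : Cardinal) ≤ tdOver S y) →
        (k : Cardinal) ≤ tdOver misSet y) →
    (∀ (n : ℕ) (x : Fin n → ℂ), LinearIndependent ℚ ((Submodule.span ℚ misSet).mkQ ∘ x) →
      ∃ (k : ℕ) (y : Fin k → ℂ), k ≤ n ∧ (∀ i, y i ∈ Submodule.span ℚ (ecl misSet)) ∧
        LinearIndependent ℚ ((Submodule.span ℚ misSet).mkQ ∘ y) ∧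
          tdOver misSet y + ((n - k : ℕ) : Cardinal) ≤ tdOver misSet x) →
    ∀ (n : ℕ) (x : Fin n → ℂ), LinearIndependent ℚ ((Submodule.span ℚ misSet).mkQ ∘ x) →
      (n : Cardinal) ≤ tdOver misSet x := by
  intro h1 h2 h3 n x hx
  obtain ⟨k, y, hkn, hy, hyl, htr⟩ := h3 n x hx
  have hk : (k : Cardinal) ≤ tdOver misSet y :=
    h2 k y (fun S hS hSM => h1 S hS hSM k y hy hyl)
  have hnk : (n : Cardinal) = (k : Cardinal) + ((n - k : ℕ) : Cardinal) := by
    rw [← Nat.cast_add, Nat.add_sub_cancel' hkn]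
  calc (n : Cardinal) = (k : Cardinal) + ((n - k : ℕ) : Cardinal) := hnk
    _ ≤ tdOver misSet y + ((n - k : ℕ) : Cardinal) := add_le_add hk le_rfl
    _ ≤ tdOver misSet x := htr

-- Sorry-freeness certificate for the glue: its axiom closure is the three standard axioms only
-- (a `sorryAx` in its cone would make this `#guard_msgs` fail, hence the file rc ≠ 0).
/--
info: 'Summit.Schanuel.Schanuel.Cruxes.OffMisiurewiczSector.Birth.offMisiurewiczSector_of_parts' depends on axioms: [propext,
 Classical.choice,
 Quot.sound]
-/
#guard_msgs in
#print axioms offMisiurewiczSector_of_parts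

/-- **The skeleton concludes the crux BY NAME** — the ONLY theorem of this file whose type is
`Summit.Schanuel.Schanuel.Theses.MisiurewiczField.OffMisiurewiczSector`; no hypotheses: the three
registered stubs are INVOKED by name and composed by the sorry-free glue
`offMisiurewiczSector_of_parts` (so `sorry` enters only through `stub_coreFiniteBase`,
`stub_directedUnion`, `stub_coreReduction`). -/
theorem OffMisiurewiczSector_of : OffMisiurewiczSector :=
  offMisiurewiczSector_iff.mpr
    (offMisiurewiczSector_of_parts stub_coreFiniteBase stub_directedUnion stub_coreReduction)

end Summit.Schanuel.Schanuel.Cruxes.OffMisiurewiczSector.Birth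

end
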